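import Summits.BirchSwinnertonDyer.Rank1Residual.Additive.QuadraticTwistTowerNoPTorsion
import Summits.BirchSwinnertonDyer.Rank1Residual.Additive.StrictSignedSelmerPreimageZero
import Summits.BirchSwinnertonDyer.Rank1Residual.Additive.SignedSelmerControlZero
import Literature.NumberTheory.EllipticCurves.IwasawaSelmerModuleFiniteProofs
import Literature.NumberTheory.EllipticCurves.IwasawaEulerCharDualityProofs
import Literature.NumberTheory.EllipticCurves.SelmerCorankProofs
import HarnessLib

/-!
# `A₀ = h₀⁻¹(S_∞)` IS FINITE AS SOON AS IT HAS FINITE EXPONENT — for every sub-Selmer family, in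
# particular `A₀ = Sel^{loc,∞}(W/ℚ)` of the (C3_η) derivation (cell `b2b-bsdres`, CLASS-CLOSURE lane,
# class O10 — x1b GEN 43, class lead; file 113 of the series: the bookkeeping half between file 112
# (the Mordell–Weil line meets `A₀` only in its `p^ν`-torsion) and file 110 (`A₀` finite ⟹
# `X^{−,str}(W/ℚ_∞)` is `Λ`-torsion with `f(0) ≠ 0`))

HONEST FRAMING (cell `b2b-bsdres`, run/shared/lean/b2b/bsd-rank1-residual/, verbatim in every
file): the goal of the cell is to DELETE the COMBINATION-SHAPED residual classes of the
Birch–Swinnerton-Dyer formula for ALL analytic-rank `≤ 1` elliptic curves over `ℚ` — "full BSD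
formula for every rank `≤ 1` curve in class `C`" assembled STRICTLY from published theorems — so
that the rank-`≤ 1` remainder becomes exactly the CONSTRUCTION-SHAPED classes, which are TYPED
(missing-input `Prop`s), NOT attempted. This is not "finishing BSD". CLASS-CLOSURE lane: prove
what is provable now; shrink each hard class to its core with data; no claim beyond stated classes;
research routes on CONSTRUCTION-SHAPED X12 / O10; census / instrument output = EVIDENCE / conjecture
items, NEVER a Literature fact; `RESIDUAL-MAP.md` marks change only by signed lines. THIS FILE:
TOOL THEOREMS ONLY (Galois-cohomology bookkeeping over the tree's objects) — no definition, no
named Literature fact, no Summits-side fact `def … : Prop`, no `sorry`, axioms standard; nothing is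
booked; no label / mark / count / sub-cell moves; (C1_η), (C2_η-GZ), (C3_η) stay typed as filed
(cc-typer-6's pen); O10 stays OPEN / CONSTRUCTION-SHAPED; nothing about `BSD(W, p)` of any pair is
claimed.

## What

For `E/K` elliptic over a number field, a `ℤ_p`-extension `κ` with topological generator `γ`, and ANY
subgroup `S_∞ ≤ Sel_{p^∞}(E/K_∞)`, put `A₀ = h₀⁻¹(S_∞) ≤ H¹(K, E[p^∞])` (`h₀ = layerToInfty κ 0`).

* §1 **`SubSelmerControlZero.finite_comap_of_pow_smul_eq_zero`**: if `E(K_∞)[p^∞] = 0` and `p^e`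
  kills `A₀`, then `A₀` is FINITE. Proof: `h₀` is injective ([K] Lemma 9.1 / Greenberg 3.1,
  `SignedControlZero.layerToInfty_zero_injective`) and carries `A₀` into `(Sel_∞)^γ[p^e]`
  (`range_layerToInfty_le_layerInvariants_holds`); `(Sel_∞)^γ[p]` is finite (Greenberg's "`X/𝔪X` is
  finite", `finite_setOf_selmerInfty_pTorsion_conjH1_eq_of_isTopGenerator`, any `ℤ_p`-extension),
  hence so is `(Sel_∞)^γ[p^e]` (`finite_torsionBy_pow`, induction along `0 → G[p] → G[p^{k+1}] → G[p^k]`).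
* §2 the instance `S_∞ = Sel^{ε,str}(E/K_∞)` (Kobayashi's STRICT signed structure in
  `W`-coordinates, p17): `StrictSignedControlZero.finite_comap_of_pow_smul_eq_zero`.
* §3 the quadratic TWIST `W` of a good supersingular `a_p = 0` curve over `ℚ`, model `ℚ_p`, `p ≥ 3`
  (`E(ℚ_∞)[p^∞] = 0` DISCHARGED, file 55; `A₀ = Sel^{loc,∞}(W/ℚ)` by B2, files 47/55):
  **`p^e · Sel^{loc,∞}(W/ℚ) = 0 ⟹ Sel^{loc,∞}(W/ℚ)` finite** — so (file 110) `X^{ε,str}(W/ℚ_∞)` is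
  `Λ`-torsion with `f(0) ≠ 0`. With file 112 (every Mordell–Weil class in `Sel^{loc,∞}` is killed by
  `p^ν`) the finiteness of `Sel^{loc,∞}(W/ℚ)` in rank one is thereby reduced to ONE statement of
  Poitou–Tate type: every class of `Sel^{loc,∞}(W/ℚ)` has a bounded `p`-power multiple on the
  Mordell–Weil line (relaxed-versus-Selmer finiteness, JSW17 Prop. 3.3.2 shape) — NOT proved here.

References: [GreenbergLNM1716] §1 p. 60 ("`X/𝔪X` is finite"), §3 Lemma 3.1–3.2 (p. 86); [Kobayashi2003]
Lemma 9.1 (p. 25), Prop. 8.7 (p. 16); [SilvermanAEC2009] X.4.3 (finiteness behind `Sel_∞[𝔪]`).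
-/

noncomputable section

open scoped Classical AddSubgroup

open WeierstrassCurve Literature.NumberTheory.EllipticCurves Literature.NumberTheory.GaloisRepresentations
  Literature.NumberTheory.EllipticCurves.IwasawaAlgebra Literature.NumberTheory.EllipticCurves.IwasawaDual
  Literature.NumberTheory.EllipticCurves.Kobayashi2003 ZpExtension

universe u

namespace Summit.BirchSwinnertonDyer.Rank1Residual.Additive

/-! ## §1 Any sub-Selmer family: `p^e · A₀ = 0` and `E(K_∞)[p^∞] = 0` ⟹ `A₀` finite -/

namespace SubSelmerControlZero

variable {K : Type u} [Field K] [NumberField K] (W : WeierstrassCurve K) [W.IsElliptic] {p : ℕ}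
  [hp : Fact p.Prime] {κ : ZpExtension K p} {γ : Field.absoluteGaloisGroup K}

/-- **`(Sel_∞)^γ[p^e]` is finite** for every `ℤ_p`-extension of a number field with topological
generator `γ` and every `e`: `(Sel_∞)^γ[p]` is finite (Greenberg's "`X/𝔪X` is finite",
`finite_setOf_selmerInfty_pTorsion_conjH1_eq_of_isTopGenerator`), and `G[p]` finite ⟹ `G[p^e]`
finite (`finite_torsionBy_pow`). [cite: GreenbergLNM1716, §1 p. 60 (after Conj. 1.3)] -/
theorem finite_torsionBy_endInvariants_conjSelmerInfty (hγ : κ.IsTopGenerator γ) (e : ℕ) :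
    Finite ((↥(endInvariants (W.conjSelmerInfty κ γ - 1)))[((p ^ e : ℕ) : ℤ)]) := by
  set G := endInvariants (W.conjSelmerInfty κ γ - 1) with hG
  -- `G[p]` is finite: it injects into `Sel_∞[p]^γ`
  haveI : Finite ((↥G)[(p : ℤ)]) := by
    have hfin := W.finite_setOf_selmerInfty_pTorsion_conjH1_eq_of_isTopGenerator κ hγ
    haveI := hfin.to_subtype
    refine Finite.of_injective (fun x : (↥G)[(p : ℤ)] ↦
      (⟨((x : G) : W.selmerInfty κ), ?_⟩ : {s : W.selmerInfty κ |
        p • s = 0 ∧ W.conjH1 p κ.kerSubgroup γ (s : W.subgroupH1 p κ.kerSubgroup) = s})) ?_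
    · refine ⟨?_, (W.mem_endInvariants_conjSelmerInfty_iff κ γ (x : G)).mp (x : G).2⟩
      have hx : p • (x : G) = 0 := AddSubgroup.torsionBy.nsmul_iff.mp x.2
      have h := congrArg (fun z : G ↦ (z : W.selmerInfty κ)) hx
      simpa using h
    · intro a b hab
      have h : (((a : G) : W.selmerInfty κ)) = ((b : G) : W.selmerInfty κ) :=
        congrArg (fun z : {s : W.selmerInfty κ |
          p • s = 0 ∧ W.conjH1 p κ.kerSubgroup γ (s : W.subgroupH1 p κ.kerSubgroup) = s} ↦ (z : W.selmerInfty κ)) hab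
      exact Subtype.ext (Subtype.ext h)
  exact Literature.NumberTheory.EllipticCurves.finite_torsionBy_pow (↥G) p e

/-- **`A₀ = h₀⁻¹(S_∞)` is finite as soon as it has finite exponent**, for ANY subgroup
`S_∞ ≤ Sel_{p^∞}(E/K_∞)`, provided `E(K_∞)[p^∞] = 0`: `h₀` is injective ([K] Lemma 9.1 / Greenberg
Lemma 3.1, `SignedControlZero.layerToInfty_zero_injective`), its image is `γ`-fixed
(`range_layerToInfty_le_layerInvariants_holds`), so `A₀ ↪ (Sel_∞)^γ[p^e]`, finite by the previous
theorem. [cite: GreenbergLNM1716, §3 Lemma 3.1 (p. 86), §1 p. 60] [cite: Kobayashi2003, Lemma 9.1 (p. 25)] -/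
theorem finite_comap_of_pow_smul_eq_zero (hγ : κ.IsTopGenerator γ)
    (hB : FixedPoints.addSubgroup κ.kerSubgroup (W.geomPrimaryTorsion p) = ⊥)
    {Sinf : AddSubgroup (W.subgroupH1 p κ.kerSubgroup)} (hle : Sinf ≤ W.selmerInfty κ) {e : ℕ}
    (he : ∀ y ∈ Sinf.comap (W.layerToInfty κ 0), p ^ e • y = 0) :
    Finite (Sinf.comap (W.layerToInfty κ 0)) := by
  set G := endInvariants (W.conjSelmerInfty κ γ - 1) with hG
  haveI := finite_torsionBy_endInvariants_conjSelmerInfty W hγ e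
  -- `h₀ y` is a `γ`-fixed Selmer class killed by `p^e`
  have hmemS : ∀ y : Sinf.comap (W.layerToInfty κ 0),
      W.layerToInfty κ 0 (y : W.subgroupH1 p (κ.layerSubgroup 0)) ∈ W.selmerInfty κ :=
    fun y ↦ hle (AddSubgroup.mem_comap.mp y.2)
  have hfix : ∀ y : Sinf.comap (W.layerToInfty κ 0),
      (⟨W.layerToInfty κ 0 (y : W.subgroupH1 p (κ.layerSubgroup 0)), hmemS y⟩ : W.selmerInfty κ) ∈ G := by
    intro y
    rw [hG, W.mem_endInvariants_conjSelmerInfty_iff κ γ]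
    have hinv := W.range_layerToInfty_le_layerInvariants_holds κ 0
      ⟨(y : W.subgroupH1 p (κ.layerSubgroup 0)), rfl⟩
    rw [mem_layerInvariants_iff] at hinv
    exact hinv γ (by rw [ZpExtension.layerSubgroup_zero]; exact Subgroup.mem_top γ)
  have htor : ∀ y : Sinf.comap (W.layerToInfty κ 0),
      (⟨⟨W.layerToInfty κ 0 (y : W.subgroupH1 p (κ.layerSubgroup 0)), hmemS y⟩, hfix y⟩ : G) ∈
        (↥G)[((p ^ e : ℕ) : ℤ)] := by
    intro y
    rw [AddSubgroup.torsionBy.nsmul_iff]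
    apply Subtype.ext; apply Subtype.ext
    change p ^ e • W.layerToInfty κ 0 (y : W.subgroupH1 p (κ.layerSubgroup 0)) = 0
    rw [← map_nsmul, he _ y.2, map_zero]
  refine Finite.of_injective (fun y ↦ (⟨_, htor y⟩ : (↥G)[((p ^ e : ℕ) : ℤ)])) ?_
  intro a b hab
  have h : W.layerToInfty κ 0 (a : W.subgroupH1 p (κ.layerSubgroup 0)) =
      W.layerToInfty κ 0 (b : W.subgroupH1 p (κ.layerSubgroup 0)) :=
    congrArg (fun z : (↥G)[((p ^ e : ℕ) : ℤ)] ↦ (((z : G) : W.selmerInfty κ) : W.subgroupH1 p κ.kerSubgroup)) hab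
  exact Subtype.ext (SignedControlZero.layerToInfty_zero_injective W hγ hB h)

end SubSelmerControlZero

/-! ## §2 Kobayashi's STRICT signed structure -/

namespace StrictSignedControlZero

section Strict

variable {K : Type u} [Field K] [NumberField K] (W : WeierstrassCurve K) [W.IsElliptic] {p : ℕ}
  [hp : Fact p.Prime] (κ : ZpExtension K p) (E : Type u) [Field E] [Algebra K E] (ε : ℤˣ)

/-- **`A₀ = h₀⁻¹(Sel^{ε,str}(E/K_∞))` is finite as soon as it has finite exponent** (given
`E(K_∞)[p^∞] = 0`; §1 at `S_∞ = Sel^{ε,str}_∞ ≤ Sel_∞`, `strictSignedSelmerInfty_le_selmerInfty`).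
[cite: GreenbergLNM1716, §3 Lemma 3.1 (p. 86), §1 p. 60] [cite: Kobayashi2003, Def. 2.1 (p. 5), Lemma 9.1 (p. 25)] -/
theorem finite_comap_of_pow_smul_eq_zero {γ : Field.absoluteGaloisGroup K} (hγ : κ.IsTopGenerator γ)
    (hB : FixedPoints.addSubgroup κ.kerSubgroup (W.geomPrimaryTorsion p) = ⊥) {e : ℕ}
    (he : ∀ y ∈ (strictSignedSelmerInfty W κ E ε).comap (W.layerToInfty κ 0), p ^ e • y = 0) :
    Finite ((strictSignedSelmerInfty W κ E ε).comap (W.layerToInfty κ 0)) :=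
  SubSelmerControlZero.finite_comap_of_pow_smul_eq_zero W hγ hB (strictSignedSelmerInfty_le_selmerInfty W κ E ε) he

end Strict

/-! ## §3 The quadratic TWIST of a good supersingular curve over `ℚ` (model `ℚ_p`) -/

section Twist

variable {p : ℕ} [hp : Fact p.Prime] (κ : ZpExtension ℚ p) (W : WeierstrassCurve ℚ) [W.IsElliptic]
  (ε : ℤˣ)

/-- **`p^e · Sel^{loc,∞}(W/ℚ) = 0 ⟹ Sel^{loc,∞}(W/ℚ)` is finite**, for `W/ℚ` elliptic with
`C • W^{(c)} = V` (`c` a non-square), `M/ℤ_p` a good supersingular model of `V` over `ℚ̄_p`, `p ≥ 3`,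
ANY `ℤ_p`-extension `κ` of `ℚ` with topological generator `γ`, any sign `ε`: (hB) `W(ℚ_∞)[p^∞] = 0`
is file 55's theorem for the twist, `Sel^{loc,∞}(W/ℚ) = h₀⁻¹(Sel^{ε,str}(W/ℚ_∞))` is B2 (file 47 with
(hS)/(htors) discharged), and §2 applies. [cite: Kobayashi2003, Prop. 8.7 (p. 16), Lemma 9.1 (p. 25)]
[cite: GreenbergLNM1716, §3 Lemma 3.1 (p. 86), §1 p. 60] -/
theorem finite_localPreimage_of_pow_smul_eq_zero_of_quadraticTwist (hp2 : p ≠ 2) {c : ℚ}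
    (hc : ∀ q : ℚ, q ^ 2 ≠ c) (C : VariableChange ℚ) {V : WeierstrassCurve ℚ} [V.IsElliptic]
    (hCV : C • W.quadraticTwist c = V) (M : WeierstrassCurve ℤ_[p]) (hΔ : IsUnit M.Δ)
    (hA : M.hasseCoeff p ∈ IsLocalRing.maximalIdeal ℤ_[p])
    (hVM : M.baseChange (AlgebraicClosure ℚ_[p]) = V.baseChange (AlgebraicClosure ℚ_[p]))
    {γ : Field.absoluteGaloisGroup ℚ} (hγ : κ.IsTopGenerator γ) {e : ℕ}
    (he : ∀ y ∈ (W.selmerInfty κ ⊓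
        ⨅ σ : Field.absoluteGaloisGroup ℚ,
          (localKummerOverOfEmb W p κ.kerSubgroup (closureEmb (K := ℚ) ℚ_[p])
              (⨆ m, strictSignedLocalPoints κ ℚ_[p] W ε m)).comap (W.conjH1 p κ.kerSubgroup σ)).comap
        (W.layerToInfty κ 0), p ^ e • y = 0) :
    Finite ↥((W.selmerInfty κ ⊓
        ⨅ σ : Field.absoluteGaloisGroup ℚ,
          (localKummerOverOfEmb W p κ.kerSubgroup (closureEmb (K := ℚ) ℚ_[p])
              (⨆ m, strictSignedLocalPoints κ ℚ_[p] W ε m)).comap (W.conjH1 p κ.kerSubgroup σ)).comap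
        (W.layerToInfty κ 0)) := by
  obtain ⟨S, hS⟩ := exists_finset_forall_not_mem_good W p
  have hA₀ := comap_layerToInfty_zero_strictSignedSelmerInfty_eq W κ ℚ_[p] ε S hS
    (eq_zero_of_prime_pow_smul_eq_zero_localFixedPointsOfEmb_kerSubgroup_of_quadraticTwist κ
      (closureEmb (K := ℚ) ℚ_[p]) hp2 W hc C hCV M hΔ hA hVM)
  rw [← hA₀] at he ⊢
  exact finite_comap_of_pow_smul_eq_zero W κ ℚ_[p] ε hγ
    (fixedPoints_kerSubgroup_geomPrimaryTorsion_eq_bot_of_quadraticTwist κ hp2 W hc C hCV M hΔ hA hVM) he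

/-- **The same for the `p*`-twist `W` of a globally minimal good supersingular `a_p = 0` curve
`V`** (consumers' binders; the model from `exists_goodSupersingularPadicModel`). For `κ` cyclotomic,
`ε = −1` this is the object of the (C3_η) derivation: `Sel^{loc,∞}(W/ℚ)` is finite — hence
(file 110) `X^{−,str}(W/ℚ_∞)` is `Λ`-torsion with `f(0) ≠ 0` — as soon as it has finite exponent;
file 112 bounds the exponent of its Mordell–Weil part by `p^ν`.
[cite: Kobayashi2003, Prop. 8.7 (p. 16), Lemma 9.1 (p. 25), Thm. 9.3 (p. 26)]
[cite: GreenbergLNM1716, §3 Lemma 3.1 (p. 86), §1 p. 60] -/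
theorem finite_localPreimage_of_pow_smul_eq_zero_of_quadraticTwist_signedPrime (hp2 : p ≠ 2)
    (C : VariableChange ℚ) (V : WeierstrassCurve ℚ) [V.IsElliptic] [V.IsGloballyMinimal]
    (hCV : C • W.quadraticTwist ((-1) ^ (p / 2) * p) = V)
    (hgood : V.HasGoodReductionAtPrime p) (hap : V.frobeniusTrace p = 0)
    {γ : Field.absoluteGaloisGroup ℚ} (hγ : κ.IsTopGenerator γ) {e : ℕ}
    (he : ∀ y ∈ (W.selmerInfty κ ⊓
        ⨅ σ : Field.absoluteGaloisGroup ℚ,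
          (localKummerOverOfEmb W p κ.kerSubgroup (closureEmb (K := ℚ) ℚ_[p])
              (⨆ m, strictSignedLocalPoints κ ℚ_[p] W ε m)).comap (W.conjH1 p κ.kerSubgroup σ)).comap
        (W.layerToInfty κ 0), p ^ e • y = 0) :
    Finite ↥((W.selmerInfty κ ⊓
        ⨅ σ : Field.absoluteGaloisGroup ℚ,
          (localKummerOverOfEmb W p κ.kerSubgroup (closureEmb (K := ℚ) ℚ_[p])
              (⨆ m, strictSignedLocalPoints κ ℚ_[p] W ε m)).comap (W.conjH1 p κ.kerSubgroup σ)).comap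
        (W.layerToInfty κ 0)) := by
  obtain ⟨M, hΔ, hA, hVM⟩ := exists_goodSupersingularPadicModel hp2 V hgood hap
  exact finite_localPreimage_of_pow_smul_eq_zero_of_quadraticTwist κ W ε hp2
    (sq_ne_neg_one_pow_mul_prime hp.out (p / 2)) C hCV M hΔ hA hVM hγ he

end Twist

end StrictSignedControlZero

end Summit.BirchSwinnertonDyer.Rank1Residual.Additive

end
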